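import Summits.QuantumFields.YangMills.Theorems.LangevinControlUVFemtoCurvatureTwoPointStrictRPDefs
import Literature.MathematicalPhysics.QuantumFieldTheory.ConstructiveQFTWave0OddRPProofs

/-!
# Crux `FemtoCurvatureTwoPoint` (stmt-QuantumFields-9363, route `LangevinControlUV`):
# strict positivity of the axis covariance — definitions for the odd torus

Route-internal vocabulary (D-0016 `Defs` file, reviewed; nothing asserted) of the strict
reflection-positivity argument on the ODD torus `(ℤ/L)^d`, `L = 2m + 1` (the tree's mixed reflection
`θ t = 1 − t` of `ConstructiveQFTWave0OddRPProofs`: link hyperplane `t = 1/2`, site hyperplane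
`t = m + 1`; positive block `P` = links with `1 ≤ t ≤ m`, crossing block `C` = temporal links `0 → 1`,
shared block `M` = spatial links at `t = m + 1`): the spatial links of the middle slice `t = m`
(`midEdges`), the temporal links `m → m + 1` (`topEdges`), the temporal plaquettes based at `t = m`
(`IsTopPlaq`: the top transfer step, `topAction`) and the rest of the odd-positive action
(`restOddAction`), the gauge function `gaugeOfTop Y` supported on the middle slice, the boundary
shift `shiftUp`, the boundary configurations `topConfig`, the doubly resampled configuration
`topSplice`, the rest weight `restOddWeight` and the real crossing-free slab functional `chiOddR`.
Companion theorem files: `…StrictRPOddTransfer`, `…StrictRPOddTransferForm`, `…StrictRPOddStrict`,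
`…StrictRPAxisPositive`.
-/

set_option autoImplicit false

noncomputable section

namespace Summit.QuantumFields.YangMills.Theorems.FemtoCurvatureTwoPoint.StrictRP

open MeasureTheory Finset
open scoped Matrix ComplexConjugate
open Literature.MathematicalPhysics.QuantumFieldTheory

section OddDefs

variable {d L N : ℕ} [NeZero d] [NeZero L] [Fact (1 < L)] {G : Type*} [Group G]
  (ρ : G →* Matrix (Fin N) (Fin N) ℂ)

/-- Spatial links of the middle slice `t = L/2` of the odd torus (just below the shared hyperplane
`t = L/2 + 1`). -/
def midEdges : Finset (Edge d L) := univ.filter fun e => e.2 ≠ 0 ∧ (e.1 0).val = L / 2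

/-- Temporal links `L/2 → L/2 + 1` (the top transfer step of the positive half). -/
def topEdges : Finset (Edge d L) := univ.filter fun e => e.2 = 0 ∧ (e.1 0).val = L / 2

/-- Temporal plaquettes based in the slice `t = L/2` (the top transfer step). -/
def IsTopPlaq (p : Plaquette d L) : Prop := p.2.1.1 = 0 ∧ (p.1 0).val = L / 2

/-- `IsTopPlaq` is decidable. -/
instance : DecidablePred (IsTopPlaq (d := d) (L := L)) := fun _ => by
  unfold IsTopPlaq; infer_instance

/-- The gauge function built from the temporal links `L/2 → L/2 + 1` of `Y`, supported on the slice
`t = L/2`: `γ_Y(x) = Y(x, 0)` there, `1` elsewhere. -/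
def gaugeOfTop (Y : GaugeConfig d L G) (x : Site d L) : G :=
  if (x 0).val = L / 2 then Y (x, 0) else 1

/-- The shared boundary seen from the middle slice: `B(x, i) = V(x + e₀, i)`. -/
def shiftUp (V : GaugeConfig d L G) : GaugeConfig d L G := fun e => V (e.1.shift 0, e.2)

omit [NeZero L] [Fact (1 < L)] [Group G] in
/-- `shiftUp` reads one step up in time. -/
theorem shiftUp_apply (V : GaugeConfig d L G) (e : Edge d L) : shiftUp V e = V (e.1.shift 0, e.2) := rfl

/-- Boundary data with prescribed shared slice (read off `A` one step down) and trivial elsewhere. -/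
def topConfig (A : GaugeConfig d L G) : GaugeConfig d L G :=
  fun e => if e ∈ (WilsonOddRP.oSharedEdges : Finset (Edge d L)) then A (e.1 - Pi.single 0 1, e.2) else 1

variable [TopologicalSpace G] [IsTopologicalGroup G] [CompactSpace G] [MeasurableSpace G] [BorelSpace G]

/-- The top transfer step: the temporal plaquettes based in the slice `t = L/2`. -/
def topAction (U : GaugeConfig d L G) : ℝ := ∑ p ∈ univ.filter IsTopPlaq, WilsonRP.plaqRe ρ U p

/-- The remaining odd-positive plaquettes. -/
def restOddAction (U : GaugeConfig d L G) : ℝ :=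
  ∑ p ∈ (univ.filter WilsonOddRP.IsOPosPlaq).filter (fun p => ¬ IsTopPlaq p), WilsonRP.plaqRe ρ U p

/-- The configuration feeding the top transfer step: positive and crossing links resampled, the
temporal links `L/2 → L/2 + 1` resampled once more. -/
def topSplice (V W Y : GaugeConfig d L G) : GaugeConfig d L G :=
  LatticeRP.splice (WilsonOddRP.oPosEdges ∪ WilsonOddRP.lowerEdges) (V, LatticeRP.splice topEdges (W, Y))

/-- The weight of the rest of the odd-positive half. -/
def restOddWeight (β : ℝ) (W : GaugeConfig d L G) : ℝ :=
  Real.exp (β * restOddAction ρ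
    (LatticeRP.splice (WilsonOddRP.oPosEdges ∪ WilsonOddRP.lowerEdges) ((fun _ => (1 : G)), W)))

/-- The real crossing-free slab functional of the odd reflection for the observable `Re tr ρ(U_q) − m`. -/
def chiOddR (β : ℝ) (q : Plaquette d L) (m : ℝ) (V : GaugeConfig d L G) : ℝ :=
  ∫ W, (WilsonRP.plaqRe ρ (LatticeRP.splice (WilsonOddRP.oPosEdges ∪ WilsonOddRP.lowerEdges) (V, W)) q - m) *
      Real.exp (β * WilsonOddRP.oPosAction ρ
        (LatticeRP.splice (WilsonOddRP.oPosEdges ∪ WilsonOddRP.lowerEdges) (V, W)))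
    ∂(LatticeRP.piMeasure (ι := Edge d L) (haarProbability G))

end OddDefs

/-- **Registered sub-goal `stub_shiftUp_apply`** (`--supports stmt-QuantumFields-9363`; anchors this definitions file): `shiftUp` reads one step up in time. [folklore] -/
theorem stub_shiftUp_apply : ∀ (d L : ℕ) [NeZero d] (G : Type) (V : Literature.MathematicalPhysics.QuantumFieldTheory.GaugeConfig d L G) (e : Literature.MathematicalPhysics.QuantumFieldTheory.Edge d L), Summit.QuantumFields.YangMills.Theorems.FemtoCurvatureTwoPoint.StrictRP.shiftUp V e = V (e.1.shift 0, e.2) := by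
  intro d L _ G V e
  rfl

end Summit.QuantumFields.YangMills.Theorems.FemtoCurvatureTwoPoint.StrictRP

end
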